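import Summits.Parity.BatemanHorn.Theorems.RoughParitySectorsOddSectorShareLinearShareOfDecoupling
import HarnessLib

/-!
# Route `RoughParitySectors`, crux `OddSectorShareLinear` (stmt-Parity-15629), line `birth`:
# bookkeeping for the mixed share step (`…MixedShareStep.lean`)

`--supports stmt-Parity-15629` file (line lead, cycle 2).  Pure-real and iterated-limit bookkeeping over
abstract cells, companion of the tree's `…ShareOfDecouplingAux.lean`: `decoupling_chain` (inverse of
`ShareOfDecoupling.share_chain`: STEP `c'·A ≈ c`, S `MP·O ≈ MO·P`, Z `P·A ≈ O` give back the decoupling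
`c'·MO ≈ c·MP`), its eventual form `decoupling_ev`, the share-factor exchange `step_congr`
(`B(U)/A(U) → 1`), and the two share factors `A₁(U) = U e^{−γ}/2 > 0`,
`T(U) = Σ_{j odd ≤ ⌊U⌋} I_j(U) > 0` with `T/A₁ → 1` (the tree's `stub_oddBuchstabMass`).
No definition, no new fact.
-/

noncomputable section

open Filter Finset Polynomial
open scoped BigOperators Topology
open Literature.NumberTheory.Sieve

namespace Summit.Parity.BatemanHorn.Cruxes.OddSectorShareLinear.Birth

namespace MixedShareStep

/-! ### Pure-real bookkeeping -/

/-- Inverse of the member-step chain: with `0 ≤ c' ≤ c ≤ MO`, `O, MP ≥ 0`, `P > 0`, `A > 0` and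
`0 ≤ η ≤ 1/8`, the statements STEP `c'·A ≈ c`, S `MP·O ≈ MO·P`, Z `P·A ≈ O` give back the decoupling
`|c'·MO − c·MP| ≤ 4η·c·MP`. [folklore] -/
theorem decoupling_chain {c' c MO MP O P A η : ℝ}
    (hη0 : 0 ≤ η) (hη1 : η ≤ 1 / 8)
    (hc' : 0 ≤ c') (hc'c : c' ≤ c) (hcMO : c ≤ MO) (hO : 0 ≤ O) (hMP : 0 ≤ MP)
    (hP : 0 < P) (hA : 0 < A)
    (hStep : |c' * A - c| ≤ η * c)
    (hS : |MP * O - MO * P| ≤ η * (MO * P))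
    (hZ : |P * A - O| ≤ η * O) :
    |c' * MO - c * MP| ≤ 4 * η * (c * MP) := by
  have hc : 0 ≤ c := hc'.trans hc'c
  rcases hc.eq_or_lt with hc0 | hc0
  · have hc'0 : c' = 0 := le_antisymm (hc0 ▸ hc'c) hc'
    rw [← hc0, hc'0]
    simp
  rw [abs_le] at hStep hS hZ ⊢
  obtain ⟨hT1, hT2⟩ := hStep
  obtain ⟨hS1, hS2⟩ := hS
  obtain ⟨hZ1, hZ2⟩ := hZ
  have hO0 : 0 < O := by
    rcases hO.eq_or_lt with h | h
    · rw [← h] at hZ2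
      have hPA := mul_pos hP hA
      linarith
    · exact h
  have hMO0 : 0 < MO := hc0.trans_le hcMO
  have h1η : 0 < 1 - η := by linarith
  have hcMP : 0 ≤ c * MP := mul_nonneg hc hMP
  -- upper bound: `c'·MO·(1−η)²·P ≤ (1+η)·c·MP·P`
  have u1 : c' * A ≤ (1 + η) * c := by linarith
  have l2 : (1 - η) * (MO * P) ≤ MP * O := by linarith
  have l3 : (1 - η) * O ≤ P * A := by linarith
  have up1 : c' * MO * ((1 - η) * P) ≤ c' * MP * O :=
    calc c' * MO * ((1 - η) * P) = c' * ((1 - η) * (MO * P)) := by ring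
      _ ≤ c' * (MP * O) := mul_le_mul_of_nonneg_left l2 hc'
      _ = c' * MP * O := by ring
  have up2 : c' * MP * O * (1 - η) ≤ (1 + η) * c * MP * P :=
    calc c' * MP * O * (1 - η) = c' * MP * ((1 - η) * O) := by ring
      _ ≤ c' * MP * (P * A) := mul_le_mul_of_nonneg_left l3 (mul_nonneg hc' hMP)
      _ = (c' * A) * (MP * P) := by ring
      _ ≤ ((1 + η) * c) * (MP * P) := mul_le_mul_of_nonneg_right u1 (mul_nonneg hMP hP.le)
      _ = (1 + η) * c * MP * P := by ring
  have up3 : P * (c' * MO * (1 - η) ^ 2) ≤ P * ((1 + η) * (c * MP)) :=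
    calc P * (c' * MO * (1 - η) ^ 2) = (c' * MO * ((1 - η) * P)) * (1 - η) := by ring
      _ ≤ (c' * MP * O) * (1 - η) := mul_le_mul_of_nonneg_right up1 h1η.le
      _ = c' * MP * O * (1 - η) := by ring
      _ ≤ (1 + η) * c * MP * P := up2
      _ = P * ((1 + η) * (c * MP)) := by ring
  have up : c' * MO * (1 - η) ^ 2 ≤ (1 + η) * (c * MP) := le_of_mul_le_mul_left up3 hP
  -- lower bound: `c·MP·A·(1−η) ≤ (1+η)²·c'·A·MO`
  have l1 : (1 - η) * c ≤ c' * A := by linarith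
  have u2 : MP * O ≤ (1 + η) * (MO * P) := by linarith
  have u3 : P * A ≤ (1 + η) * O := by linarith
  have lo1 : c * MP * (P * A) ≤ (1 + η) ^ 2 * c * MO * P :=
    calc c * MP * (P * A) ≤ c * MP * ((1 + η) * O) := mul_le_mul_of_nonneg_left u3 hcMP
      _ = (1 + η) * c * (MP * O) := by ring
      _ ≤ (1 + η) * c * ((1 + η) * (MO * P)) :=
          mul_le_mul_of_nonneg_left u2 (mul_nonneg (by linarith) hc)
      _ = (1 + η) ^ 2 * c * MO * P := by ring
  have lo2 : P * (c * MP * A) ≤ P * ((1 + η) ^ 2 * c * MO) :=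
    calc P * (c * MP * A) = c * MP * (P * A) := by ring
      _ ≤ (1 + η) ^ 2 * c * MO * P := lo1
      _ = P * ((1 + η) ^ 2 * c * MO) := by ring
  have lo3 : c * MP * A ≤ (1 + η) ^ 2 * c * MO := le_of_mul_le_mul_left lo2 hP
  have lo4 : A * ((1 - η) * (c * MP)) ≤ A * ((1 + η) ^ 2 * (c' * MO)) :=
    calc A * ((1 - η) * (c * MP)) = (1 - η) * (c * MP * A) := by ring
      _ ≤ (1 - η) * ((1 + η) ^ 2 * c * MO) := mul_le_mul_of_nonneg_left lo3 h1η.le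
      _ = (1 + η) ^ 2 * MO * ((1 - η) * c) := by ring
      _ ≤ (1 + η) ^ 2 * MO * (c' * A) :=
          mul_le_mul_of_nonneg_left l1 (mul_nonneg (by positivity) hMO0.le)
      _ = A * ((1 + η) ^ 2 * (c' * MO)) := by ring
  have lo : (1 - η) * (c * MP) ≤ (1 + η) ^ 2 * (c' * MO) := le_of_mul_le_mul_left lo4 hA
  -- polynomial bookkeeping for `η ≤ 1/8`
  have hsq : 0 ≤ η ^ 2 := sq_nonneg η
  have hcu : 0 ≤ η ^ 3 := pow_nonneg hη0 3
  have p2 : η ^ 2 ≤ η / 8 := by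
    have h := mul_le_mul_of_nonneg_left hη1 hη0
    have e : η ^ 2 = η * η := sq η
    rw [e]
    linarith
  have hc'MO : 0 ≤ c' * MO := mul_nonneg hc' hMO0.le
  have h2pos : 0 < (1 - η) ^ 2 := pow_pos h1η 2
  have h3pos : 0 < (1 + η) ^ 2 := pow_pos (by linarith) 2
  -- from `up`: `c' MO ≤ (1+4η) c MP` because `(1+η) ≤ (1+4η)(1−η)²`
  have x1 : (1 + 4 * η) * (1 - η) ^ 2 = 1 + 2 * η - 7 * η ^ 2 + 4 * η ^ 3 := by ring
  have e1' : (1 + η) ≤ (1 + 4 * η) * (1 - η) ^ 2 := by rw [x1]; linarith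
  have e1 : (1 + η) * (c * MP) ≤ (1 + 4 * η) * (1 - η) ^ 2 * (c * MP) :=
    mul_le_mul_of_nonneg_right e1' hcMP
  have f1 : c' * MO * (1 - η) ^ 2 ≤ ((1 + 4 * η) * (c * MP)) * (1 - η) ^ 2 := by
    calc c' * MO * (1 - η) ^ 2 ≤ (1 + η) * (c * MP) := up
      _ ≤ (1 + 4 * η) * (1 - η) ^ 2 * (c * MP) := e1
      _ = ((1 + 4 * η) * (c * MP)) * (1 - η) ^ 2 := by ring
  have g1 : c' * MO ≤ (1 + 4 * η) * (c * MP) := le_of_mul_le_mul_right f1 h2pos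
  -- from `lo`: `(1−4η) c MP ≤ c' MO` because `(1−4η)(1+η)² ≤ 1−η`
  have x2 : (1 - 4 * η) * (1 + η) ^ 2 = 1 - 2 * η - 7 * η ^ 2 - 4 * η ^ 3 := by ring
  have e2' : (1 - 4 * η) * (1 + η) ^ 2 ≤ 1 - η := by rw [x2]; linarith
  have e2 : (1 - 4 * η) * (1 + η) ^ 2 * (c * MP) ≤ (1 - η) * (c * MP) :=
    mul_le_mul_of_nonneg_right e2' hcMP
  have f2 : ((1 - 4 * η) * (c * MP)) * (1 + η) ^ 2 ≤ (c' * MO) * (1 + η) ^ 2 := by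
    calc ((1 - 4 * η) * (c * MP)) * (1 + η) ^ 2 = (1 - 4 * η) * (1 + η) ^ 2 * (c * MP) := by ring
      _ ≤ (1 - η) * (c * MP) := e2
      _ ≤ (1 + η) ^ 2 * (c' * MO) := lo
      _ = (c' * MO) * (1 + η) ^ 2 := by ring
  have g2 : (1 - 4 * η) * (c * MP) ≤ c' * MO := le_of_mul_le_mul_right f2 h3pos
  have y1 : (1 + 4 * η) * (c * MP) = c * MP + 4 * η * (c * MP) := by ring
  have y2 : (1 - 4 * η) * (c * MP) = c * MP - 4 * η * (c * MP) := by ring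
  rw [y1] at g1
  rw [y2] at g2
  constructor <;> linarith

/-! ### Iterated-limit bookkeeping over abstract cells -/

/-- **D from the mixed share step** over abstract cells: with `c' ≤ c ≤ MO`, `P > 0` eventually (for
`U ≥ 2`) and `A(U) > 0` (`U > 0`), the statements STEP `c'·A(U) ≈ c`, S `MP·O ≈ MO·P` and Z `P·A ≈ O`
give the decoupling `|c'·MO − c·MP| ≤ η·c·MP` for `U ≥ U₀(η)`, eventually in `x`. [folklore] -/
theorem decoupling_ev {c' c MO MP O P : ℝ → ℕ → ℕ} {A : ℝ → ℝ}
    (hc'c : ∀ U x, c' U x ≤ c U x) (hcMO : ∀ U x, c U x ≤ MO U x)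
    (hP : ∀ U : ℝ, 2 ≤ U → ∀ᶠ x : ℕ in atTop, 0 < P U x) (hA : ∀ U : ℝ, 0 < U → 0 < A U)
    (hStep : ∀ η : ℝ, 0 < η → ∃ U₀ : ℝ, ∀ U : ℝ, U₀ ≤ U → ∀ᶠ x : ℕ in atTop,
      |(c' U x : ℝ) * A U - (c U x : ℝ)| ≤ η * (c U x : ℝ))
    (hS : ∀ η : ℝ, 0 < η → ∃ U₀ : ℝ, ∀ U : ℝ, U₀ ≤ U → ∀ᶠ x : ℕ in atTop,
      |(MP U x : ℝ) * (O U x : ℝ) - (MO U x : ℝ) * (P U x : ℝ)| ≤ η * ((MO U x : ℝ) * (P U x : ℝ)))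
    (hZ : ∀ η : ℝ, 0 < η → ∃ U₀ : ℝ, ∀ U : ℝ, U₀ ≤ U → ∀ᶠ x : ℕ in atTop,
      |(P U x : ℝ) * A U - (O U x : ℝ)| ≤ η * (O U x : ℝ)) :
    ∀ η : ℝ, 0 < η → ∃ U₀ : ℝ, ∀ U : ℝ, U₀ ≤ U → ∀ᶠ x : ℕ in atTop,
      |(c' U x : ℝ) * (MO U x : ℝ) - (c U x : ℝ) * (MP U x : ℝ)| ≤ η * ((c U x : ℝ) * (MP U x : ℝ)) := by
  intro η hη
  have hη' : 0 < min (η / 4) (1 / 8) := lt_min (by positivity) (by norm_num)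
  obtain ⟨U₁, h₁⟩ := hStep _ hη'
  obtain ⟨U₂, h₂⟩ := hS _ hη'
  obtain ⟨U₃, h₃⟩ := hZ _ hη'
  refine ⟨max (max U₁ U₂) (max U₃ 2), fun U hU => ?_⟩
  simp only [max_le_iff] at hU
  obtain ⟨⟨hU₁, hU₂⟩, hU₃, hU2⟩ := hU
  have hU0 : 0 < U := by linarith
  filter_upwards [h₁ U hU₁, h₂ U hU₂, h₃ U hU₃, hP U hU2] with x hTx hSx hZx hPx
  have key := decoupling_chain hη'.le (min_le_right _ _) (Nat.cast_nonneg _)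
    (by exact_mod_cast hc'c U x) (by exact_mod_cast hcMO U x)
    (Nat.cast_nonneg _) (Nat.cast_nonneg _) (by exact_mod_cast hPx) (hA U hU0) hTx hSx hZx
  calc _ ≤ 4 * min (η / 4) (1 / 8) * ((c U x : ℝ) * (MP U x : ℝ)) := key
    _ ≤ η * ((c U x : ℝ) * (MP U x : ℝ)) := by
        apply mul_le_mul_of_nonneg_right _ (by positivity)
        linarith [min_le_left (η / 4) (1 / 8)]

/-- **Exchanging the share factor**: if `B(U)/A(U) → 1` as `U → ∞` (`A > 0` for large `U`), a step statement
`|c'·A(U) − c| ≤ η·c` (all `η > 0`, `U ≥ U₀(η)`, eventually in `x`) implies the same statement with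
`B` in place of `A`. [folklore] -/
theorem step_congr {c' c : ℝ → ℕ → ℕ} {A B : ℝ → ℝ} {U₁ : ℝ} (hA : ∀ U : ℝ, U₁ ≤ U → 0 < A U)
    (hBA : Tendsto (fun U => B U / A U) atTop (𝓝 1))
    (h : ∀ η : ℝ, 0 < η → ∃ U₀ : ℝ, ∀ U : ℝ, U₀ ≤ U → ∀ᶠ x : ℕ in atTop,
      |(c' U x : ℝ) * A U - (c U x : ℝ)| ≤ η * (c U x : ℝ)) :
    ∀ η : ℝ, 0 < η → ∃ U₀ : ℝ, ∀ U : ℝ, U₀ ≤ U → ∀ᶠ x : ℕ in atTop,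
      |(c' U x : ℝ) * B U - (c U x : ℝ)| ≤ η * (c U x : ℝ) := by
  intro η hη
  have hε : 0 < min (η / 3) 1 := lt_min (by positivity) one_pos
  set ε : ℝ := min (η / 3) 1 with hε_def
  have hε3 : ε ≤ η / 3 := min_le_left _ _
  have hε1 : ε ≤ 1 := min_le_right _ _
  obtain ⟨U₃, hU₃⟩ := Metric.tendsto_atTop.mp hBA ε hε
  obtain ⟨U₂, hU₂⟩ := h ε hε
  refine ⟨max (max U₂ U₃) U₁, fun U hU => ?_⟩
  simp only [max_le_iff] at hU
  obtain ⟨⟨hUb, hUc⟩, hUa⟩ := hU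
  have hAU : 0 < A U := hA U hUa
  have hq : |B U / A U - 1| < ε := by
    have := hU₃ U hUc
    rwa [Real.dist_eq] at this
  filter_upwards [hU₂ U hUb] with x hx
  have hc : (0 : ℝ) ≤ (c U x : ℝ) := Nat.cast_nonneg _
  -- `c'B − c = (c'A − c)·(B/A) + c·(B/A − 1)`
  have e : (c' U x : ℝ) * B U - (c U x : ℝ) =
      ((c' U x : ℝ) * A U - (c U x : ℝ)) * (B U / A U) + (c U x : ℝ) * (B U / A U - 1) := by
    field_simp
    ring
  rw [e]
  have hq1 : |B U / A U| ≤ 1 + ε := by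
    have := abs_sub_abs_le_abs_sub (B U / A U) 1
    rw [abs_one] at this
    linarith [hq.le]
  calc |((c' U x : ℝ) * A U - (c U x : ℝ)) * (B U / A U) + (c U x : ℝ) * (B U / A U - 1)|
      ≤ |((c' U x : ℝ) * A U - (c U x : ℝ)) * (B U / A U)| + |(c U x : ℝ) * (B U / A U - 1)| :=
        abs_add_le _ _
    _ = |(c' U x : ℝ) * A U - (c U x : ℝ)| * |B U / A U| + (c U x : ℝ) * |B U / A U - 1| := by
        rw [abs_mul, abs_mul, abs_of_nonneg hc]
    _ ≤ (ε * (c U x : ℝ)) * (1 + ε) + (c U x : ℝ) * ε := by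
        have h1 := mul_le_mul hx hq1 (abs_nonneg _) (by positivity)
        have h2 := mul_le_mul_of_nonneg_left hq.le hc
        linarith
    _ = (2 * ε + ε * ε) * (c U x : ℝ) := by ring
    _ ≤ (2 * ε + ε) * (c U x : ℝ) := by
        apply mul_le_mul_of_nonneg_right _ hc
        have : ε * ε ≤ ε * 1 := mul_le_mul_of_nonneg_left hε1 hε.le
        linarith
    _ ≤ η * (c U x : ℝ) := by
        apply mul_le_mul_of_nonneg_right _ hc
        linarith

/-- `A₁(U) = U e^{−γ}/2 > 0` for `U > 0`. [folklore] -/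
theorem shareA_pos (U : ℝ) (hU : 0 < U) : 0 < U * Real.exp (-Real.eulerMascheroniConstant) / 2 := by
  positivity

/-- The odd Buchstab mass `T(U) = Σ_{j odd ≤ ⌊U⌋} I_j(U) ≥ I_1(U) = 1 > 0` for `U ≥ 1`. [folklore] -/
theorem oddMass_pos (U : ℝ) (hU : 1 ≤ U) :
    0 < ∑ j ∈ (range (⌊U⌋₊ + 1)).filter Odd, roughCellDensity j U := by
  have hfl : 1 ≤ ⌊U⌋₊ := Nat.le_floor (by exact_mod_cast hU)
  have h1 : (1 : ℕ) ∈ (range (⌊U⌋₊ + 1)).filter Odd :=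
    mem_filter.2 ⟨mem_range.2 (by omega), odd_one⟩
  calc (0 : ℝ) < 1 := one_pos
    _ = roughCellDensity 1 U := (roughCellDensity_one_of_one_le hU).symm
    _ ≤ ∑ j ∈ (range (⌊U⌋₊ + 1)).filter Odd, roughCellDensity j U :=
        single_le_sum (f := fun j => roughCellDensity j U) (fun j _ => roughCellDensity_nonneg j U) h1

/-- `T(U)/A₁(U) → 1` as `U → ∞` (the tree's `stub_oddBuchstabMass`). [folklore] -/
theorem tendsto_oddMass_div_shareA :
    Tendsto (fun U : ℝ => (∑ j ∈ (range (⌊U⌋₊ + 1)).filter Odd, roughCellDensity j U) /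
      (U * Real.exp (-Real.eulerMascheroniConstant) / 2)) atTop (𝓝 1) :=
  OddSectorShareNonlinear.Birth.stub_oddBuchstabMass

end MixedShareStep

/-- **Sub-goal (pure-real bookkeeping of the D ⟺ mixed-share-step equivalence)**, registered on crux
stmt-Parity-15629 as `stub_decouplingChain`, verbatim: with `0 ≤ c⁽ᵐ⁺¹⁾ ≤ c⁽ᵐ⁾ ≤ O_m`, `O_ℤ, P_m ≥ 0`,
`P_ℤ > 0`, `A > 0`, `0 ≤ η ≤ 1/8`, the statements STEP `c⁽ᵐ⁺¹⁾·A ≈ c⁽ᵐ⁾`, S `P_m·O_ℤ ≈ O_m·P_ℤ`,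
Z `P_ℤ·A ≈ O_ℤ` give D `|c⁽ᵐ⁺¹⁾·O_m − c⁽ᵐ⁾·P_m| ≤ 4η·c⁽ᵐ⁾·P_m` (`MixedShareStep.decoupling_chain`).
[folklore] -/
theorem stub_decouplingChain :
    ∀ (cn cm MO MP O P A η : ℝ), 0 ≤ η → η ≤ 1 / 8 → 0 ≤ cn → cn ≤ cm → cm ≤ MO → 0 ≤ O → 0 ≤ MP →
    0 < P → 0 < A → |cn * A - cm| ≤ η * cm → |MP * O - MO * P| ≤ η * (MO * P) → |P * A - O| ≤ η * O
    → |cn * MO - cm * MP| ≤ 4 * η * (cm * MP) :=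
  fun _ _ _ _ _ _ _ _ hη0 hη1 hc' hc'c hcMO hO hMP hP hA hT hS hZ =>
    MixedShareStep.decoupling_chain hη0 hη1 hc' hc'c hcMO hO hMP hP hA hT hS hZ

end Summit.Parity.BatemanHorn.Cruxes.OddSectorShareLinear.Birth

end
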